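import Literature.NumberTheory.GaloisRepresentations.WeakAbelianDirectSummandRatCyclotomicProofs
import Literature.NumberTheory.GaloisRepresentations.WeakAbelianDirectSummandRatExponentProofs
import Literature.NumberTheory.GaloisRepresentations.WeakAbelianDirectSummandCyclotomicPowerProofs
import HarnessLib

/-!
# Böckle–Hui, Theorem 1.1 (characters, Hecke form) over `K = ℚ` (proved)

Topic `NumberTheory/GaloisRepresentations`; namespace
`Literature.NumberTheory.GaloisRepresentations`.  A *proofs* file (theorems only; no definition,
no named fact, no instance), sibling of `WeakAbelianDirectSummand.lean`, whose named fact
`exists_heckeCharacter_of_weaklyDivides` (Böckle–Hui 2025, Thm. 1.1 for characters, in the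
Hecke-character form of BH §3.2.1) is stated for an arbitrary number field `K`.

**Theorem** (`exists_heckeCharacter_of_weaklyDivides_rat`) — the case `K = ℚ` of the named fact,
unconditionally: *let `ℓ` be a prime, `E` a number field with `e : E → ℚ̄_ℓ`,
`ρ : Γ_ℚ →ₜ* GL_n(ℚ̄_ℓ)` an `E`-rational `ℓ`-adic representation and `ψ : Γ_ℚ →ₜ* GL_1(ℚ̄_ℓ)` a
character weakly dividing `ρ` (BH Def. 2.3).  Then for every field isomorphism `ι : ℚ̄_ℓ ≃ ℂ` there
is an algebraic Hecke character `χ` of `ℚ` with `χ`, `ψ` unramified and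
`ψ(Frob_p) = ι⁻¹(χ(ϖ_p))⁻¹` at all but finitely many `p`.*

The proof is Böckle–Hui's (§2.7), assembled from the sibling proofs files along the printed steps:

1. Steps 1–2 (`ψ^N` locally algebraic — BH Thm. 2.2, here Serre's six-exponentials argument over
   `ℚ` — hence `E'`-rational; over `ℚ`: `ψ^M = χ_ℓ^c`):
   `WeaklyDivides.exists_pow_eq_cyclotomic_pow_rat` (`…RatCyclotomicProofs`, resting on
   `…IdelicProofs`, `…RatLocAlgProofs`, `LAdicCharacterIdelic(Values)Proofs`,
   `PadicCharacterLocallyAlgebraicProofs`, `SixExponentialsPadicProofs`);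
2. Steps 3–4 (Prop. 2.11: `E'`-rationality of `ψ` off the exceptional eigenvalue locus, by gcd
   descent; Prop. 2.12: hence `ψ` locally algebraic; over `ℚ`: `ψ^{M'} = χ_ℓ^{M'd}`):
   `WeaklyDivides.exists_pow_eq_cyclotomic_pow_mul_rat` (`…RatExponentProofs`, resting on
   `…GcdDescentProofs`, `…DivisibilityProofs` (Prop. 2.4), `FrobeniusDensityOneProofs`);
3. the Hecke avatar (BH §2.4 (Loc-alg) ⇒ (E-SCS), §3.2.1): a character with `ψ^{M'} = χ_ℓ^{M'd}`
   is `χ_ℓ^d ·` (finite order) and comes from the algebraic Hecke character `‖·‖^{-d} · ω`, `ω` of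
   finite order by Artin reciprocity:
   `FramedGaloisRep.exists_heckeCharacter_of_pow_eq_cyclotomic_pow` (`…CyclotomicPowerProofs`).

The semisimplicity hypothesis of Thm. 1.1 is not needed (and not assumed): `E`-rationality and
weak divisibility only see characteristic polynomials, i.e. the semisimplification of `ρ`.
For a general number field `K`, Step 1 requires the several-variables `ℓ`-adic transcendence
theorem of Waldschmidt (1981, Part II) / Henniart (1982) (BH Thm. 2.2), which the tree does not
yet have; Steps 0, 2–4 and the Hecke avatar are field-independent in the sibling files.

## References

* [BockleHui2025] G. Böckle, C.-Y. Hui, *Weak abelian direct summands and irreducibility of Galois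
  representations*, Math. Ann. 393 (2025): Thm. 1.1, §2.7 (proof), Thm. 2.2, Prop. 2.4, 2.11, 2.12,
  §2.4, §3.2.1.
* [SerreAbelianLadic1968] J.-P. Serre, *Abelian ℓ-adic representations and elliptic curves*,
  Ch. III §§1.2, 2.3, 3 (locally algebraic characters; the case `K = ℚ`).
-/

noncomputable section

open scoped NumberField Polynomial
open NumberField IsDedekindDomain Field Polynomial Filter
open Rat.HeightOneSpectrum

namespace Literature.NumberTheory.GaloisRepresentations

/-- **Böckle–Hui 2025, Theorem 1.1 for characters, Hecke form, over `K = ℚ`** — the case `K = ℚ`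
of the named fact `exists_heckeCharacter_of_weaklyDivides` (without its semisimplicity
hypothesis, which is not needed): if `ρ : Γ_ℚ →ₜ* GL_n(ℚ̄_ℓ)` is `E`-rational and the character
`ψ : Γ_ℚ →ₜ* GL_1(ℚ̄_ℓ)` weakly divides `ρ`, then for every `ι : ℚ̄_ℓ ≃+* ℂ` there is an algebraic
Hecke character `χ` of `ℚ` such that, at all but finitely many places `v`, `χ` and `ψ` are
unramified and `ψ.HasFrobCharpolyAt v (X - C (ι⁻¹ (χ(ϖ_v))⁻¹))`.  Assembled from
`WeaklyDivides.exists_pow_eq_cyclotomic_pow_rat` (Steps 1–2: `ψ^M = χ_ℓ^c`),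
`WeaklyDivides.exists_pow_eq_cyclotomic_pow_mul_rat` (Steps 3–4: `ψ^{M'} = χ_ℓ^{M'd}`) and
`FramedGaloisRep.exists_heckeCharacter_of_pow_eq_cyclotomic_pow` (the Hecke avatar), after
identifying `ℓ` with the prime under a place `v₀` of `ℚ`.
[cite: BockleHui2025, Theorem 1.1 and §2.7 (proof), §3.2.1] -/
theorem exists_heckeCharacter_of_weaklyDivides_rat (ℓ : ℕ) [Fact ℓ.Prime] (n : ℕ)
    (E : Type) [Field E] [NumberField E] (e : E →+* PadicAlgCl ℓ)
    (ρ : FramedGaloisRep ℚ (PadicAlgCl ℓ) n) (hρ : ρ.IsRationalOver e)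
    (ψ : FramedGaloisRep ℚ (PadicAlgCl ℓ) 1) (h : ψ.WeaklyDivides ρ) (ι : PadicAlgCl ℓ ≃+* ℂ) :
    ∃ χ : HeckeCharacter ℚ, χ.IsAlgebraic ∧
      ∀ᶠ v : HeightOneSpectrum (𝓞 ℚ) in cofinite, χ.IsUnramifiedAt v ∧ ψ.IsUnramifiedAt v ∧
        ψ.HasFrobCharpolyAt v (X - C (ι.symm (χ.valueAtUniformizer v)⁻¹)) := by
  -- `ℓ = p_{v₀}` for the place `v₀ = (ℓ)` of `ℚ`
  obtain ⟨v₀, hv₀⟩ : ∃ v₀ : HeightOneSpectrum (𝓞 ℚ), natGenerator v₀ = ℓ :=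
    ⟨(primesEquiv (R := 𝓞 ℚ)).symm ⟨ℓ, Fact.out⟩,
      congrArg Subtype.val ((primesEquiv (R := 𝓞 ℚ)).apply_symm_apply ⟨ℓ, Fact.out⟩)⟩
  subst hv₀
  -- Steps 1–2: `ψ^M = χ_ℓ^c`
  obtain ⟨M, hM, c, hMc⟩ := FramedGaloisRep.WeaklyDivides.exists_pow_eq_cyclotomic_pow_rat v₀ e hρ h
  -- Steps 3–4: `ψ^{M'} = χ_ℓ^{M' d}`
  obtain ⟨M', hM', d, hd⟩ :=
    FramedGaloisRep.WeaklyDivides.exists_pow_eq_cyclotomic_pow_mul_rat e hρ h hM hMc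
  -- the Hecke avatar
  exact FramedGaloisRep.exists_heckeCharacter_of_pow_eq_cyclotomic_pow ψ hM' d hd ι

/-- The case `K = ℚ` of the named fact `exists_heckeCharacter_of_weaklyDivides`, in its exact
shape (with the — here superfluous — semisimplicity hypothesis).
[cite: BockleHui2025, Theorem 1.1 and §3.2.1] -/
theorem exists_heckeCharacter_of_weaklyDivides_rat' (ℓ : ℕ) [Fact ℓ.Prime] (n : ℕ)
    (E : Type) [Field E] [NumberField E] (e : E →+* PadicAlgCl ℓ)
    (ρ : FramedGaloisRep ℚ (PadicAlgCl ℓ) n) (_hss : ρ.toGaloisRep.IsSemisimple)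
    (hρ : ρ.IsRationalOver e) (ψ : FramedGaloisRep ℚ (PadicAlgCl ℓ) 1) (h : ψ.WeaklyDivides ρ)
    (ι : PadicAlgCl ℓ ≃+* ℂ) :
    ∃ χ : HeckeCharacter ℚ, χ.IsAlgebraic ∧
      ∀ᶠ v : HeightOneSpectrum (𝓞 ℚ) in cofinite, χ.IsUnramifiedAt v ∧ ψ.IsUnramifiedAt v ∧
        ψ.HasFrobCharpolyAt v (X - C (ι.symm (χ.valueAtUniformizer v)⁻¹)) :=
  exists_heckeCharacter_of_weaklyDivides_rat ℓ n E e ρ hρ ψ h ι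

end Literature.NumberTheory.GaloisRepresentations
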